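import Mathlib
import Summits.Ventures.HodgeRepro2.A2Galois
import Summits.Ventures.HodgeRepro2.A2BaseChange
import Summits.Ventures.HodgeRepro2.A2Avoidance

/-!
# T6A2Projector — sub-claim A2, (S2)'s carrier-free core: the rational projector onto a Galois-stable set
of eigenlines (LEMMA A4.2.2) and the avoidance choice of θ_i ((A4.2.7), LEMMA A4.2.6)

Cell pub-hodge-repro2, Tier 6 (README §10), seat t6-p2. Proof lane: no new definition except the two
abbreviations `proj` / `coordProj` (polynomials in the operator). GLUE over the ACCEPTED Tier-4 kernel of
seat p6 (TARGET-T6.md §2 Layer II): `A2Galois.lagrangeIndicator` + `exists_polynomial_map_eq_lagrangeIndicator`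
(the rationality of the Lagrange projector, Lemma A4.2.2(ii)), `A2BaseChange.isIdempotentElem_of_baseChange` /
`range_baseChange` / `finrank_baseChange` (the base-change parentheses of Lemma A4.2.2), `A2Avoidance.ker_ne_top_of_ne_zero`
/ `exists_notMem_of_forall_ne_top` (Lemma A4.2.6). Nothing of Tier 4 is restated.

Setting (abstract, carrier-free — the application is V = H²(A_i, ℚ), T = ι_i(x)^* for the separating x of
Lemma A4.2.1, F = ℚ, L = τ₁(F) ⊂ ℂ (Galois over ℚ, containing every eigenvalue σ(x)σ'(x)), K = ℂ, Λ = the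
eigenvalues of ι_i(x)^* on H²(A_i, ℂ), Λ_W = the three conjugate-pair eigenvalues τ_ν(x)τ̄_ν(x)): F ⊆ L ⊆ K
fields, L/F finite Galois, V an F-vector space, T an F-linear endomorphism whose K-base change is
diagonalisable with eigenvalues in the image of a finite set Λ ⊂ L, and Λ_W ⊆ Λ a Gal(L/F)-stable subset.

Results:
* `aeval_apply_of_mem_eigenspace`, `aeval_eq_zero_of_forall_eval_eq_zero` — a polynomial in T_K acts on each
  eigenspace by its value, and vanishes if its values on Λ vanish;
* `isIdempotentElem_projK`, `range_projK` — the Lagrange polynomial P_{Λ,Λ_W}(T_K) is the projector onto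
  ⊕_{λ ∈ Λ_W} E_λ along the other eigenspaces;
* `exists_rational_projector` — LEMMA A4.2.2: an F-RATIONAL idempotent p = Q(T), Q ∈ F[X], with
  (range p) ⊗ K = ⊕_{λ ∈ Λ_W} E_λ and dim_F (range p) = dim_K ⊕_{λ ∈ Λ_W} E_λ;
* `exists_mem_range_forall_coordProj_ne_zero` — (A4.2.7): a rational θ in the image of such a p all of whose
  eigen-components (λ ∈ Λ_W) are non-zero (needs F infinite and every E_λ, λ ∈ Λ_W, non-zero).
-/

namespace Summit.Ventures.HodgeRepro2.T6.A2Projector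

open Polynomial Module TensorProduct

section EigenPolynomial

variable {K : Type*} [Field K] {W : Type*} [AddCommGroup W] [Module K W]

/-- A polynomial in an endomorphism acts on an eigenvector (possibly zero) by the polynomial's value at the
eigenvalue (`Module.End.aeval_apply_of_hasEigenvector` without the non-vanishing hypothesis). -/
theorem aeval_apply_of_mem_eigenspace (f : End K W) {μ : K} {v : W} (hv : v ∈ f.eigenspace μ)
    (p : K[X]) : aeval f p v = p.eval μ • v := by
  by_cases h : v = 0
  · subst h; simp
  · exact Module.End.aeval_apply_of_hasEigenvector ⟨hv, h⟩

/-- If the eigenspaces of `f` for the eigenvalues `e λ`, `λ : ι`, span `W`, then a polynomial vanishing at every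
`e λ` vanishes at `f`. -/
theorem aeval_eq_zero_of_forall_eval_eq_zero {ι : Type*} (f : End K W) (e : ι → K)
    (hspan : ⨆ i, f.eigenspace (e i) = ⊤) (p : K[X]) (hp : ∀ i, p.eval (e i) = 0) : aeval f p = 0 := by
  ext v
  have hv : v ∈ ⨆ i, f.eigenspace (e i) := by rw [hspan]; exact Submodule.mem_top
  simp only [LinearMap.zero_apply]
  refine Submodule.iSup_induction (motive := fun v => aeval f p v = 0) _ hv ?_ ?_ ?_
  · intro i x hx
    rw [aeval_apply_of_mem_eigenspace f hx, hp i, zero_smul]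
  · simp
  · intro x y hx hy
    rw [map_add, hx, hy, add_zero]

end EigenPolynomial

section Projector

variable {F L K : Type*} [Field F] [Field L] [Field K] [Algebra L K] [Algebra F K] [DecidableEq L]
variable {V : Type*} [AddCommGroup V] [Module F V]

variable (K) in
/-- The eigenspace E_λ of the base change `T_K` for the image of `λ ∈ L`. -/
noncomputable abbrev eig (T : End F V) (l : L) : Submodule K (K ⊗[F] V) :=
  Module.End.eigenspace (T.baseChange K) (algebraMap L K l)

variable (K) in
/-- The Lagrange projector polynomial of `A2Galois`, base-changed from `L` to `K`, evaluated in the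
`K`-base change `T_K` of `T`: the candidate projector onto ⊕_{λ ∈ Λ_W} E_λ. -/
noncomputable abbrev projK (T : End F V) (Λ ΛW : Finset L) : End K (K ⊗[F] V) :=
  aeval (T.baseChange K) ((A2Galois.lagrangeIndicator Λ ΛW).map (algebraMap L K))

variable (K) in
/-- The projector onto the single eigenspace of `λ`, `λ ∈ Λ`: the case `Λ_W = {λ}`. -/
noncomputable abbrev coordProj (T : End F V) (Λ : Finset L) (l : L) : End K (K ⊗[F] V) :=
  projK K T Λ {l}

/-- The value of the base-changed Lagrange polynomial at the image of an eigenvalue. -/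
theorem eval_map_lagrangeIndicator (Λ ΛW : Finset L) {l : L} (hl : l ∈ Λ) :
    ((A2Galois.lagrangeIndicator Λ ΛW).map (algebraMap L K)).eval (algebraMap L K l) =
      if l ∈ ΛW then 1 else 0 := by
  rw [eval_map, eval₂_hom, A2Galois.lagrangeIndicator_eval Λ ΛW l hl]
  split_ifs <;> simp

/-- `projK` acts on the eigenspace of `λ ∈ Λ` as the identity if `λ ∈ Λ_W` and as zero otherwise. -/
theorem projK_apply_of_mem_eigenspace (T : End F V) (Λ ΛW : Finset L) {l : L} (hl : l ∈ Λ)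
    {v : K ⊗[F] V} (hv : v ∈ eig K T l) :
    projK K T Λ ΛW v = if l ∈ ΛW then v else 0 := by
  rw [projK, aeval_apply_of_mem_eigenspace _ hv, eval_map_lagrangeIndicator Λ ΛW hl]
  split_ifs <;> simp

variable (K) in
/-- The eigenspaces of `T_K` for `Λ` span `K ⊗ V` (the diagonalisability hypothesis of Lemma A4.2.2). -/
def Diagonalisable (T : End F V) (Λ : Finset L) : Prop :=
  ⨆ l : Λ, eig K T l.1 = ⊤

/-- LEMMA A4.2.2, projector identity: `projK` is idempotent. -/
theorem isIdempotentElem_projK (T : End F V) (Λ ΛW : Finset L)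
    (hdiag : Diagonalisable K T Λ) : IsIdempotentElem (projK K T Λ ΛW) := by
  set P : K[X] := (A2Galois.lagrangeIndicator Λ ΛW).map (algebraMap L K) with hP
  have h : aeval (T.baseChange K) (P * P - P) = 0 := by
    refine aeval_eq_zero_of_forall_eval_eq_zero (T.baseChange K)
      (fun l : Λ => algebraMap L K l) hdiag _ ?_
    intro l
    rw [eval_sub, eval_mul, hP, eval_map_lagrangeIndicator Λ ΛW l.2]
    split_ifs <;> simp
  rw [map_sub, map_mul, sub_eq_zero] at h
  exact h

/-- LEMMA A4.2.2, image: the range of `projK` is ⊕_{λ ∈ Λ_W} E_λ (for `Λ_W ⊆ Λ`). -/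
theorem range_projK (T : End F V) (Λ ΛW : Finset L) (hsub : ΛW ⊆ Λ)
    (hdiag : Diagonalisable K T Λ) :
    LinearMap.range (projK K T Λ ΛW) = ⨆ l : ΛW, eig K T l.1 := by
  apply le_antisymm
  · rintro _ ⟨v, rfl⟩
    have hv : v ∈ ⨆ l : Λ, eig K T l.1 := by
      rw [hdiag]; exact Submodule.mem_top
    refine Submodule.iSup_induction
      (motive := fun v => projK K T Λ ΛW v ∈ ⨆ l : ΛW, eig K T l.1) _ hv ?_ ?_ ?_
    · intro l x hx
      rw [projK_apply_of_mem_eigenspace T Λ ΛW l.2 hx]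
      split_ifs with hW
      · exact Submodule.mem_iSup_of_mem ⟨l.1, hW⟩ hx
      · exact Submodule.zero_mem _
    · simp
    · intro x y hx hy
      rw [map_add]; exact Submodule.add_mem _ hx hy
  · refine iSup_le fun l => ?_
    intro v hv
    refine ⟨v, ?_⟩
    rw [projK_apply_of_mem_eigenspace T Λ ΛW (hsub l.2) hv, if_pos l.2]

/-- `coordProj` is the identity on the eigenspace of `λ ∈ Λ`. -/
theorem coordProj_apply_of_mem_eigenspace (T : End F V) (Λ : Finset L) {l : L} (hl : l ∈ Λ)
    {v : K ⊗[F] V} (hv : v ∈ eig K T l) :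
    coordProj K T Λ l v = v := by
  rw [coordProj, projK_apply_of_mem_eigenspace T Λ {l} hl hv, if_pos (Finset.mem_singleton_self l)]

/-- (A4.2.7) with LEMMA A4.2.6: if `D ⊆ V` is an `F`-subspace with `D ⊗ K = ⊕_{λ ∈ Λ_W} E_λ` and every `E_λ`,
`λ ∈ Λ_W`, is non-zero, then (F infinite) some `θ ∈ D` has ALL its eigen-components `λ ∈ Λ_W` non-zero:
`coordProj T Λ λ (1 ⊗ θ) ≠ 0` for every `λ ∈ Λ_W`. -/
theorem exists_mem_forall_coordProj_ne_zero [Infinite F] (T : End F V) (Λ ΛW : Finset L)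
    (hsub : ΛW ⊆ Λ) (D : Submodule F V)
    (hD : D.baseChange K = ⨆ l : ΛW, eig K T l.1)
    (hne : ∀ l : ΛW, eig K T l.1 ≠ ⊥) :
    ∃ θ ∈ D, ∀ l ∈ ΛW, coordProj K T Λ l ((1 : K) ⊗ₜ[F] θ) ≠ 0 := by
  classical
  -- the F-linear functionals θ ↦ π_λ(1 ⊗ θ) on D
  let φ : ΛW → (D →ₗ[F] K ⊗[F] V) := fun l =>
    (((coordProj K T Λ l).restrictScalars F).comp (TensorProduct.mk F K V 1)).comp D.subtype
  have hφ : ∀ l : ΛW, φ l ≠ 0 := by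
    intro l hl
    apply hne l
    -- π_λ vanishes on D ⊗ K = span of the 1 ⊗ d
    have hker : D.baseChange K ≤ LinearMap.ker (coordProj K T Λ l) := by
      rw [Submodule.baseChange_eq_span, Submodule.span_le]
      rintro _ ⟨d, hd, rfl⟩
      have := congrArg (fun f => f ⟨d, hd⟩) hl
      simpa [φ] using this
    rw [eq_bot_iff]
    intro v hv
    have h1 : v ∈ D.baseChange K := by
      rw [hD]; exact Submodule.mem_iSup_of_mem l hv
    have h2 := hker h1
    rw [LinearMap.mem_ker, coordProj_apply_of_mem_eigenspace T Λ (hsub l.2) hv] at h2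
    rw [h2]; exact Submodule.zero_mem _
  obtain ⟨θ, hθ⟩ := A2Avoidance.exists_notMem_of_forall_ne_top
    (Finset.univ.image fun l : ΛW => LinearMap.ker (φ l)) (by
      intro U hU
      obtain ⟨l, -, rfl⟩ := Finset.mem_image.mp hU
      exact A2Avoidance.ker_ne_top_of_ne_zero (φ l) (hφ l))
  refine ⟨θ.1, θ.2, fun l hl => ?_⟩
  have := hθ (LinearMap.ker (φ ⟨l, hl⟩)) (Finset.mem_image_of_mem _ (Finset.mem_univ _))
  rw [LinearMap.mem_ker] at this
  simpa [φ] using this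

/-- The base change of `Q(T)`, `Q ∈ F[X]`, is `Q(T_K)` read over `K`. -/
theorem baseChange_aeval (T : End F V) (Q : F[X]) :
    (aeval T Q).baseChange K = aeval (T.baseChange K) (Q.map (algebraMap F K)) := by
  rw [aeval_map_algebraMap]
  exact (Polynomial.aeval_algHom_apply (Module.End.baseChangeHom F K V) T Q).symm

variable [Algebra F L] [IsScalarTower F L K]

/-- LEMMA A4.2.2: for `L/F` finite Galois and `Λ_W ⊆ Λ ⊂ L` both `Gal(L/F)`-stable, there is an `F`-RATIONAL
idempotent `p = Q(T)`, `Q ∈ F[X]`, whose `K`-base change is the projector `projK` onto ⊕_{λ ∈ Λ_W} E_λ; hence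
`(range p) ⊗ K = ⊕_{λ ∈ Λ_W} E_λ` and `dim_F (range p) = dim_K ⊕_{λ ∈ Λ_W} E_λ`. -/
theorem exists_rational_projector [IsGalois F L] [FiniteDimensional F L] (T : End F V)
    (Λ ΛW : Finset L) (hsub : ΛW ⊆ Λ) (hΛ : ∀ σ : Gal(L/F), ∀ x ∈ Λ, σ x ∈ Λ)
    (hΛW : ∀ σ : Gal(L/F), ∀ x ∈ ΛW, σ x ∈ ΛW) (hdiag : Diagonalisable K T Λ) :
    ∃ p : End F V, (∃ Q : F[X], p = aeval T Q) ∧ IsIdempotentElem p ∧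
      p.baseChange K = projK K T Λ ΛW ∧
      (LinearMap.range p).baseChange K = (⨆ l : ΛW, eig K T l.1) ∧
      Module.finrank F (LinearMap.range p) =
        Module.finrank K ↥(⨆ l : ΛW, eig K T l.1) := by
  obtain ⟨Q, hQ⟩ := A2Galois.exists_polynomial_map_eq_lagrangeIndicator Λ ΛW hΛ hΛW
  have hbc : (aeval T Q).baseChange K = projK K T Λ ΛW := by
    rw [baseChange_aeval, projK, ← hQ, Polynomial.map_map, ← IsScalarTower.algebraMap_eq]
  have hrange : (LinearMap.range (aeval T Q)).baseChange K =
      ⨆ l : ΛW, eig K T l.1 := by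
    rw [← A2BaseChange.range_baseChange, hbc, range_projK T Λ ΛW hsub hdiag]
  refine ⟨aeval T Q, ⟨Q, rfl⟩, ?_, hbc, hrange, ?_⟩
  · apply A2BaseChange.isIdempotentElem_of_baseChange (K := K)
    rw [hbc]
    exact isIdempotentElem_projK T Λ ΛW hdiag
  · rw [← hrange, A2BaseChange.finrank_baseChange]

end Projector

end Summit.Ventures.HodgeRepro2.T6.A2Projector
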